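import Literature.NumberTheory.Sieve.IwaniecAlmostPrimesLemma4
import Literature.NumberTheory.Sieve.AsymptoticSieveForPrimesReduction
import Literature.NumberTheory.Sieve.IwaniecAlmostPrimesQuadraticRootSlices
import Literature.NumberTheory.Sieve.IwaniecAlmostPrimesQuadraticRhoMeanValue
import HarnessLib

/-!
# Iwaniec (1978) for a general quadratic `G`: Lemma 4 for `𝒜_G` in relative form, from a bound for the root exponential sums

H. Iwaniec, *Almost-primes represented by quadratic polynomials*, Invent. Math. **47** (1978)
171–188, Lemma 4 (p. 177) for `𝒜_G`; R. J. Lemke Oliver, Acta Arith. **151** (2012), Lemma 4 =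
Lemma 8 and its proof, (3.4)–(3.5), pp. 254–255: the window count
`P(M₁, M; q, d, μ, ω, α, β)` for the roots of `G(Ω) ≡ 0 (mod mq)` is `(β − α)` times the total
count up to the exponential sums `∑ e(hΩ/(mq))` over the family, `h ≠ 0`.  General-`G` copy of
`IwaniecAlmostPrimesLemma4.lean` (thirteenth file of the inline proof of `theorem_quadratic`).
Everything here is PROVED; no named fact is introduced.

* `rootExpSumBoundG a b c` — the one input: Iwaniec's estimate (11), p. 180 / Lemke Oliver's
  (3.5), for the family `lemma4FamilyG` (`IwaniecAlmostPrimesQuadraticRootSlices.lean`), as a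
  PREDICATE with parameters (a hypothesis, never a closed named fact; the shape is the conclusion
  of the tree's `norm_rootExpSum_le` — proved for `G = X² + 1`, `rootExpSumBoundG_one_zero_one` —
  with the factor `∑_{l∣Q} ρ(lq)` replaced by `K^{ω(Q)}`, which is what the class counting of the
  slice engine produces for a general `G`; it is being established for every irreducible `G` by
  the forms correspondence of `IwaniecAlmostPrimesQuadratic{RootsForms,FundDomain,Phase}.lean`);
* `lemma4_windowG` — **Lemma 4 for `𝒜_G`, relative form**: for `ε > 0` there are `C ≥ 0`, `K ≥ 1`
  with, for `Q` squarefree, `q ∣ Q`, `d ∣ q`, `A ≥ 2`, `0 ≤ α ≤ β ≤ 1`,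
  `|P(α, β) − (β − α) P(0, 1)| ≤ 4 P(0,1)/A^{1/4} + C d K^{ω(Q)} (1 + log 16A)² S^{1/2+ε} S`
  (`S = ⌊√(Bq)⌋`; the Fejér-kernel form of Erdős–Turán exactly as in the tree's `lemma4_window`);
* `card_rootsG_filter_modEq` (CRT: the roots of `G` mod `nd` in the class of a root `ω` mod `d`
  number `ρ_G(n)` for `(n, d) = 1`), `card_lemma4FamilyG_eq_sum`,
  `card_lemma4FamilyG_eq` — the total count `P(0, 1) = ρ_G(q/d) (Σ₀(B) − Σ₀(A))`,
  `Σ₀(Y) = ∑_{m ≤ Y, (m,Q)=1, m ≡ μ (d)} ρ_G(m)` (`rhoSumAPG`, `IwaniecAlmostPrimesQuadraticRhoMeanValue.lean`).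

## References

* H. Iwaniec, Invent. Math. 47 (1978) 171–188, Lemma 4 and §4 pp. 179–181 (`IwaniecInventiones1978`).
* R. J. Lemke Oliver, Acta Arith. 151 (2012) 241–261, Lemma 4, Lemma 8, (3.4)–(3.5)
  (`LemkeOliverActaArith2012`).
-/

noncomputable section

open Finset Real
open scoped FourierTransform

namespace Literature.NumberTheory.Sieve.Iwaniec1978

variable {a b c : ℤ}

/-- `k mod m ≡ k (mod m)` for the integer casts. [folklore] -/
private theorem natCast_mod_modEq' (k m : ℕ) : ((k % m : ℕ) : ℤ) ≡ (k : ℤ) [ZMOD m] := by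
  rw [Int.natCast_mod]; exact Int.mod_modEq _ _

/-! ### The input: a bound for the root exponential sums over the Lemma-4 family -/

/-- **The root exponential sums of Lemma 4 for `𝒜_G`** (Iwaniec (11), p. 180; Lemke Oliver (3.5)):
for every `ε > 0` there are `C ≥ 0` and `K ≥ 1` such that for `Q` squarefree, `q ∣ Q`, `d ∣ q`,
`A ≥ 2`, any `B, μ, ω` and every integer `h ≠ 0`,
`|∑_{(m,Θ) ∈ lemma4FamilyG} e(hΘ/(mq))| ≤ C d K^{ω(Q)} τ(|h|) (3 + 8π|h|/(Aq)) S^{1/2+ε} S`,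
`S = ⌊√(Bq)⌋`.  A predicate with parameters (the hypothesis of `lemma4_windowG`); for `G = X² + 1`
it is the tree's PROVED `norm_rootExpSum_le` (`rootExpSumBoundG_one_zero_one`).
[cite: IwaniecInventiones1978, §4 pp. 180–181] -/
def rootExpSumBoundG (a b c : ℤ) : Prop :=
  ∀ ε : ℝ, 0 < ε → ∃ C K : ℝ, 0 ≤ C ∧ 1 ≤ K ∧
    ∀ (q Q d μ ω A B : ℕ) (h : ℤ), Squarefree Q → q ∣ Q → d ∣ q → 2 ≤ A → h ≠ 0 →
      ‖∑ p ∈ lemma4FamilyG a b c q Q d μ ω A B, (𝐞 ((h : ℝ) * p.2 / (p.1 * q)) : ℂ)‖ ≤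
        C * d * K ^ Q.primeFactors.card * (h.natAbs.divisors.card : ℝ) *
          (3 + 8 * Real.pi * |(h : ℝ)| / (A * q)) *
          ((Nat.sqrt (B * q) : ℝ) ^ (1 / 2 + ε) * Nat.sqrt (B * q))

/-- `∑_{l ∣ Q} ρ(lq) ≤ 8^{ω(Q)}` for `Q` squarefree and `q ∣ Q` (`ρ(n) ≤ τ(n)`,
`τ(lq) ≤ τ(l)τ(q) ≤ τ(Q)²`, `τ(Q) = 2^{ω(Q)}`). [folklore] -/
theorem sum_divisors_rho_mul_le {Q q : ℕ} (hQ : Squarefree Q) (hqQ : q ∣ Q) :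
    ∑ l ∈ Q.divisors, (rho (l * q) : ℝ) ≤ (8 : ℝ) ^ Q.primeFactors.card := by
  have hQ0 : Q ≠ 0 := hQ.ne_zero
  have hτQ : Q.divisors.card = 2 ^ Q.primeFactors.card :=
    Literature.NumberTheory.Sieve.card_divisors_of_squarefree hQ
  have hτle : ∀ {n : ℕ}, n ∣ Q → n.divisors.card ≤ Q.divisors.card := fun h =>
    Finset.card_le_card (Nat.divisors_subset_of_dvd hQ0 h)
  have hρ : ∀ l ∈ Q.divisors, (rho (l * q) : ℝ) ≤ ((Q.divisors.card ^ 2 : ℕ) : ℝ) := by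
    intro l hl
    have hlQ : l ∣ Q := Nat.dvd_of_mem_divisors hl
    have h1 : rho (l * q) ≤ (l * q).divisors.card := rho_le_card_divisors _
    have h2 : (l * q).divisors.card ≤ l.divisors.card * q.divisors.card := by
      rw [Nat.divisors_mul]; exact Finset.card_mul_le
    have h3 : l.divisors.card * q.divisors.card ≤ Q.divisors.card ^ 2 := by
      rw [sq]; exact Nat.mul_le_mul (hτle hlQ) (hτle hqQ)
    exact_mod_cast h1.trans (h2.trans h3)
  calc ∑ l ∈ Q.divisors, (rho (l * q) : ℝ) ≤ ∑ l ∈ Q.divisors, ((Q.divisors.card ^ 2 : ℕ) : ℝ) :=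
        Finset.sum_le_sum hρ
    _ = ((Q.divisors.card * Q.divisors.card ^ 2 : ℕ) : ℝ) := by
        rw [Finset.sum_const, nsmul_eq_mul]; push_cast; ring
    _ = (8 : ℝ) ^ Q.primeFactors.card := by
        rw [hτQ]; push_cast
        rw [← pow_mul, ← pow_add, show (8 : ℝ) = 2 ^ 3 by norm_num, ← pow_mul]
        congr 1; ring

/-- **The predicate holds for `G = X² + 1`** (the tree's `norm_rootExpSum_le`, via
`lemma6_hooley_holds`, with `∑_{l∣Q} ρ(lq) ≤ 4^{ω(Q)}`). [cite: IwaniecInventiones1978, §4 pp. 180–181] -/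
theorem rootExpSumBoundG_one_zero_one : rootExpSumBoundG 1 0 1 := by
  intro ε hε
  obtain ⟨C, hC0, hC⟩ := norm_rootExpSum_le lemma6_hooley_holds hε
  refine ⟨C, 8, hC0, by norm_num, ?_⟩
  intro q Q d μ ω A B h hQ hqQ hdq hA hh
  have hQ0 : Q ≠ 0 := hQ.ne_zero
  have hq : 0 < q := Nat.pos_of_dvd_of_pos hqQ (Nat.pos_of_ne_zero hQ0)
  rw [lemma4FamilyG_one_zero_one]
  refine (hC q Q d μ ω A B h hQ0 hq hdq hA hh).trans ?_
  have h1 := sum_divisors_rho_mul_le hQ hqQ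
  have hd0 : (0 : ℝ) ≤ d := Nat.cast_nonneg _
  have h3 : 0 ≤ 3 + 8 * Real.pi * |(h : ℝ)| / (A * q) := by positivity
  have hτ : (0 : ℝ) ≤ (h.natAbs.divisors.card : ℝ) := Nat.cast_nonneg _
  have hS : 0 ≤ (Nat.sqrt (B * q) : ℝ) ^ (1 / 2 + ε) * Nat.sqrt (B * q) := by positivity
  have : C * d * (∑ l ∈ Q.divisors, (rho (l * q) : ℝ)) ≤ C * d * (8 : ℝ) ^ Q.primeFactors.card :=
    mul_le_mul_of_nonneg_left h1 (by positivity)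
  gcongr

/-! ### Lemma 4 for `𝒜_G`: equidistribution of the roots in windows -/

/-- **Iwaniec 1978, Lemma 4 for `𝒜_G`, relative form — PROVED from `rootExpSumBoundG`.**  For
every `ε > 0` there are `C ≥ 0`, `K ≥ 1` such that for `Q` squarefree, `q ∣ Q`, `d ∣ q`, `A ≥ 2`,
any `B, μ, ω` and `0 ≤ α ≤ β ≤ 1`, the number `P(α, β)` of pairs
`(m, Θ) ∈ lemma4FamilyG a b c q Q d μ ω A B` with `α ≤ Θ/(mq) < β` satisfies
`|P(α, β) − (β − α) P(0, 1)| ≤ 4 P(0,1)/A^{1/4} + C d K^{ω(Q)} (1 + log(16A))² S^{1/2+ε} S`,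
`S = ⌊√(Bq)⌋` (Fejér-kernel Erdős–Turán with `H = ⌊√A⌋ + 15`, `δ = (H+1)^{-1/2}`, the root
exponential sums, `∑_{h ≤ H} τ(h)/h ≤ (1 + log H)²`). [cite: IwaniecInventiones1978, Lemma 4] -/
theorem lemma4_windowG (h4 : rootExpSumBoundG a b c) {ε : ℝ} (hε : 0 < ε) :
    ∃ C K : ℝ, 0 ≤ C ∧ 1 ≤ K ∧ ∀ (q Q d μ ω A B : ℕ) (α β : ℝ), Squarefree Q → q ∣ Q → d ∣ q → 2 ≤ A →
      0 ≤ α → α ≤ β → β ≤ 1 →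
      |(((lemma4FamilyG a b c q Q d μ ω A B).filter (fun p : ℕ × ℕ =>
            α ≤ (p.2 : ℝ) / (p.1 * q) ∧ (p.2 : ℝ) / (p.1 * q) < β)).card : ℝ) -
          (β - α) * (lemma4FamilyG a b c q Q d μ ω A B).card| ≤
        4 * (lemma4FamilyG a b c q Q d μ ω A B).card / (A : ℝ) ^ (1 / 4 : ℝ) +
          C * d * K ^ Q.primeFactors.card * (1 + Real.log (16 * A)) ^ 2 *
            ((Nat.sqrt (B * q) : ℝ) ^ (1 / 2 + ε) * Nat.sqrt (B * q)) := by
  obtain ⟨C, K, hC0, hK1, hC⟩ := h4 ε hε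
  refine ⟨2 * C * (3 + 8 * Real.pi * 16), K, by positivity, hK1, ?_⟩
  intro q Q d μ ω A B α β hQsf hqQ hdq hA hα hαβ hβ
  have hQ : Q ≠ 0 := hQsf.ne_zero
  have hq : 0 < q := Nat.pos_of_dvd_of_pos hqQ (Nat.pos_of_ne_zero hQ)
  set fam := lemma4FamilyG a b c q Q d μ ω A B with hfam
  set x : ℕ × ℕ → ℝ := fun p => (p.2 : ℝ) / (p.1 * q) with hx
  set H : ℕ := Nat.sqrt A + 15 with hH
  set R : ℝ := K ^ Q.primeFactors.card with hR
  set P : ℝ := (Nat.sqrt (B * q) : ℝ) ^ (1 / 2 + ε) * Nat.sqrt (B * q) with hP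
  have hd : 0 < d := Nat.pos_of_dvd_of_pos hdq hq
  have hA0 : (0 : ℝ) < A := by exact_mod_cast (by omega : 0 < A)
  have hR0 : 0 ≤ R := by rw [hR]; exact pow_nonneg (by linarith) _
  have hP0 : 0 ≤ P := by rw [hP]; positivity
  clear_value R P
  -- the window is a condition on a fractional part
  have hwindow : fam.filter (fun p : ℕ × ℕ =>
        α ≤ (p.2 : ℝ) / (p.1 * q) ∧ (p.2 : ℝ) / (p.1 * q) < β) =
      fam.filter (fun p => Int.fract (x p - α) < β - α) := by
    refine Finset.filter_congr fun p hp => ?_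
    rw [hfam, mem_lemma4FamilyG, mem_rootsG] at hp
    have hm0 : (0 : ℝ) < p.1 * q := by
      have : 0 < p.1 := by omega
      positivity
    have hx0 : 0 ≤ x p := by rw [hx]; positivity
    have hx1 : x p < 1 := by
      rw [hx]; dsimp only
      rw [div_lt_one hm0]; exact_mod_cast hp.2.2.2.1.1
    rw [fract_sub_lt_iff hx0 hx1 hα hαβ hβ]
  -- Fejér counting with `δ = (H+1)^{-1/2}`
  have hH16 : (16 : ℝ) ≤ H + 1 := by
    have : (16 : ℕ) ≤ H + 1 := by rw [hH]; omega
    exact_mod_cast this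
  have hH1pos : (0 : ℝ) < H + 1 := by linarith
  set σ : ℝ := Real.sqrt (H + 1) with hσ
  have hsq : σ ^ 2 = H + 1 := Real.sq_sqrt hH1pos.le
  have hσ4 : 4 ≤ σ := by
    rw [hσ, show (4 : ℝ) = Real.sqrt 16 by
      rw [show (16 : ℝ) = 4 ^ 2 by norm_num, Real.sqrt_sq (by norm_num)]]
    exact Real.sqrt_le_sqrt hH16
  have hσpos : 0 < σ := by linarith
  set δ : ℝ := 1 / σ with hδ
  have hδpos : 0 < δ := by rw [hδ]; positivity
  have hδ4 : δ ≤ 1 / 4 := by rw [hδ]; exact one_div_le_one_div_of_le (by norm_num) hσ4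
  have hHδ : ((H : ℝ) + 1) * δ = σ := by
    rw [hδ, ← hsq]; field_simp
  have hHδ1 : 1 ≤ ((H : ℝ) + 1) * δ := by rw [hHδ]; linarith
  have hup := FejerCounting.card_filter_fract_lt_le (H := H) fam x hαβ (by linarith) hδpos hδ4 hHδ1
  have hlo := FejerCounting.le_card_filter_fract_lt (H := H) fam x (α := α) (β := β)
    (by linarith) hδpos (by linarith)
  rw [← hwindow] at hup hlo
  -- the exponential sums
  set E : ℝ := ∑ dd ∈ (Finset.Icc (-(H : ℤ)) H).erase 0,
    ‖∑ i ∈ fam, (𝐞 ((dd : ℝ) * x i) : ℂ)‖ / |(dd : ℝ)| with hE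
  have hEbound : E ≤ 2 * C * (3 + 8 * Real.pi * 16) * d * R * (1 + Real.log (16 * A)) ^ 2 * P := by
    have hterm : ∀ dd ∈ (Finset.Icc (-(H : ℤ)) H).erase 0,
        ‖∑ i ∈ fam, (𝐞 ((dd : ℝ) * x i) : ℂ)‖ / |(dd : ℝ)| ≤
          C * d * R * (3 + 8 * Real.pi * 16) * P *
            (((dd.natAbs).divisors.card : ℝ) / dd.natAbs) := by
      intro dd hdd
      rw [Finset.mem_erase, Finset.mem_Icc] at hdd
      have hdd0 : dd ≠ 0 := hdd.1
      have habs : |(dd : ℝ)| = (dd.natAbs : ℝ) := by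
        rw [Nat.cast_natAbs, Int.cast_abs]
      have habs0 : 0 < (dd.natAbs : ℝ) := by exact_mod_cast Int.natAbs_pos.mpr hdd0
      have hsum : ∑ i ∈ fam, (𝐞 ((dd : ℝ) * x i) : ℂ) =
          ∑ p ∈ lemma4FamilyG a b c q Q d μ ω A B, (𝐞 ((dd : ℝ) * p.2 / (p.1 * q)) : ℂ) := by
        refine Finset.sum_congr rfl fun p _ => ?_
        rw [hx]; dsimp only; rw [mul_div_assoc]
      have hmain := hC q Q d μ ω A B dd hQsf hqQ hdq hA hdd0
      rw [← hsum, ← hR, ← hP] at hmain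
      -- `|dd| ≤ H ≤ 16 A ≤ 16 A q`
      have hfrac : 3 + 8 * Real.pi * |(dd : ℝ)| / (A * q) ≤ 3 + 8 * Real.pi * 16 := by
        have hq1 : (1 : ℝ) ≤ q := by exact_mod_cast hq
        have hddH : |(dd : ℝ)| ≤ H := by
          rw [habs]
          have : dd.natAbs ≤ H := by omega
          exact_mod_cast this
        have hHA : (H : ℝ) ≤ 16 * A := by
          have : H ≤ 16 * A := by
            rw [hH]; have := Nat.sqrt_le_self A; omega
          exact_mod_cast this
        have hAq : (A : ℝ) ≤ (A : ℝ) * q := by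
          have := mul_le_mul_of_nonneg_left hq1 hA0.le; simpa using this
        have h1 : |(dd : ℝ)| / (A * q) ≤ 16 := by
          rw [div_le_iff₀ (by positivity)]
          calc |(dd : ℝ)| ≤ H := hddH
            _ ≤ 16 * A := hHA
            _ ≤ 16 * (A * q) := by linarith
        have h2 : 8 * Real.pi * |(dd : ℝ)| / (A * q) = 8 * Real.pi * (|(dd : ℝ)| / (A * q)) := by
          ring
        rw [h2]
        have := mul_le_mul_of_nonneg_left h1 (by positivity : 0 ≤ 8 * Real.pi)
        linarith
      have hτ0 : (0 : ℝ) ≤ ((dd.natAbs).divisors.card : ℝ) := Nat.cast_nonneg _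
      have hnum : C * d * R * ((dd.natAbs).divisors.card : ℝ) *
          (3 + 8 * Real.pi * |(dd : ℝ)| / (A * q)) * P ≤
          C * d * R * ((dd.natAbs).divisors.card : ℝ) * (3 + 8 * Real.pi * 16) * P := by
        have h0 : 0 ≤ C * d * R * ((dd.natAbs).divisors.card : ℝ) := by positivity
        exact mul_le_mul_of_nonneg_right (mul_le_mul_of_nonneg_left hfrac h0) hP0
      rw [habs, div_le_iff₀ habs0]
      refine (hmain.trans hnum).trans (le_of_eq ?_)
      rw [mul_assoc (C * d * R * (3 + 8 * Real.pi * 16) * P), div_mul_cancel₀ _ habs0.ne']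
      ring
    calc E ≤ ∑ dd ∈ (Finset.Icc (-(H : ℤ)) H).erase 0,
          C * d * R * (3 + 8 * Real.pi * 16) * P * (((dd.natAbs).divisors.card : ℝ) / dd.natAbs) :=
          Finset.sum_le_sum hterm
      _ = C * d * R * (3 + 8 * Real.pi * 16) * P *
            ∑ dd ∈ (Finset.Icc (-(H : ℤ)) H).erase 0,
              (((dd.natAbs).divisors.card : ℝ) / dd.natAbs) := by
          rw [Finset.mul_sum]
      _ = C * d * R * (3 + 8 * Real.pi * 16) * P *
            (2 * ∑ h ∈ Finset.Icc 1 H, ((Nat.divisors h).card : ℝ) / h) := by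
          congr 1
          rw [sum_Icc_erase_zero_eq_two_mul
            (fun dd : ℤ => ((dd.natAbs).divisors.card : ℝ) / dd.natAbs) (fun dd => by simp)]
          simp
      _ ≤ C * d * R * (3 + 8 * Real.pi * 16) * P * (2 * (1 + Real.log (16 * A)) ^ 2) := by
          have hH1 : 1 ≤ H := by rw [hH]; omega
          have h1 := sum_card_divisors_div_le hH1
          have hlog : Real.log H ≤ Real.log (16 * A) := by
            refine Real.log_le_log (by exact_mod_cast (by omega : 0 < H)) ?_
            have : H ≤ 16 * A := by rw [hH]; have := Nat.sqrt_le_self A; omega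
            exact_mod_cast this
          have hlog0 : 0 ≤ 1 + Real.log H := by
            have := Real.log_nonneg (by exact_mod_cast hH1 : (1 : ℝ) ≤ H); linarith
          have h2 : (1 + Real.log H) ^ 2 ≤ (1 + Real.log (16 * A)) ^ 2 := by
            apply pow_le_pow_left₀ hlog0; linarith
          have hc : 0 ≤ C * d * R * (3 + 8 * Real.pi * 16) * P := by positivity
          exact mul_le_mul_of_nonneg_left (by linarith) hc
      _ = 2 * C * (3 + 8 * Real.pi * 16) * d * R * (1 + Real.log (16 * A)) ^ 2 * P := by ring
  -- `√(H+1) ≥ A^{1/4}`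
  have hroot : (A : ℝ) ^ (1 / 4 : ℝ) ≤ σ := by
    have h1 : Real.sqrt A ≤ (H : ℝ) + 1 := by
      have := Real.real_sqrt_le_nat_sqrt_succ (a := A)
      have h' : ((Nat.sqrt A : ℕ) : ℝ) + 1 ≤ (H : ℝ) + 1 := by
        have : Nat.sqrt A ≤ H := by rw [hH]; omega
        have : ((Nat.sqrt A : ℕ) : ℝ) ≤ H := by exact_mod_cast this
        linarith
      linarith
    have h2 : (A : ℝ) ^ (1 / 4 : ℝ) = Real.sqrt (Real.sqrt A) := by
      rw [Real.sqrt_eq_rpow, Real.sqrt_eq_rpow, ← Real.rpow_mul hA0.le]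
      norm_num
    rw [h2, hσ]
    exact Real.sqrt_le_sqrt h1
  have hA4 : 0 < (A : ℝ) ^ (1 / 4 : ℝ) := Real.rpow_pos_of_pos hA0 _
  -- assembly
  set N : ℝ := (fam.card : ℝ) with hN
  have hN0 : 0 ≤ N := Nat.cast_nonneg _
  have hδN : 2 * δ * N = 2 * (N / σ) := by rw [hδ]; ring
  have hHδN : 2 * N / ((H + 1) * δ) = 2 * (N / σ) := by rw [hHδ]; ring
  have hHδN' : N / ((H + 1) * δ) = N / σ := by rw [hHδ]
  rw [hδN, hHδN] at hup
  rw [hδN, hHδN'] at hlo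
  have hNσ : N / σ ≤ N / (A : ℝ) ^ (1 / 4 : ℝ) := div_le_div_of_nonneg_left hN0 hA4 hroot
  have hNσ0 : 0 ≤ N / σ := by positivity
  have key : 4 * N / (A : ℝ) ^ (1 / 4 : ℝ) = 4 * (N / (A : ℝ) ^ (1 / 4 : ℝ)) := mul_div_assoc _ _ _
  rw [key, abs_le]
  constructor
  · linarith [hlo, hEbound, hNσ, hNσ0]
  · linarith [hup, hEbound, hNσ, hNσ0]


/-! ### The total count: `#family = ρ_G(q/d) · (Σ₀(B) − Σ₀(A))` -/

/-- **Roots of `G` with a prescribed residue**: for `n d` coprime and `ω` a root of `G` mod `d`,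
`#{0 ≤ Θ < nd : nd ∣ G(Θ), Θ ≡ ω (mod d)} = ρ_G(n)` (Chinese remainder theorem). [folklore] -/
theorem card_rootsG_filter_modEq {n d ω : ℕ} (hn : 0 < n) (hd : 0 < d) (hnd : n.Coprime d)
    (hω : (d : ℤ) ∣ quadVal a b c ω) :
    ((rootsG a b c (n * d)).filter (fun Θ => Θ ≡ ω [MOD d])).card = rhoG a b c n := by
  rw [← card_rootsG n]
  -- `Θ ↦ Θ mod n`
  refine Finset.card_bij (fun Θ _ => Θ % n) ?_ ?_ ?_
  · intro Θ hΘ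
    rw [Finset.mem_filter, mem_rootsG] at hΘ
    rw [mem_rootsG]
    refine ⟨Nat.mod_lt _ hn, ?_⟩
    have h1 : (n : ℤ) ∣ quadVal a b c Θ := (Int.natCast_dvd_natCast.2 (dvd_mul_right n d)).trans
      (by exact_mod_cast hΘ.1.2)
    exact dvd_quadVal_of_modEq (natCast_mod_modEq' Θ n).symm h1
  · intro x hx y hy hxy
    rw [Finset.mem_filter, mem_rootsG] at hx hy
    have h1 : x ≡ y [MOD n] := hxy
    have h2 : x ≡ y [MOD d] := hx.2.trans hy.2.symm
    have h3 : x ≡ y [MOD n * d] := (Nat.modEq_and_modEq_iff_modEq_mul hnd).mp ⟨h1, h2⟩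
    exact Nat.ModEq.eq_of_lt_of_lt h3 hx.1.1 hy.1.1
  · intro θ hθ
    rw [mem_rootsG] at hθ
    obtain ⟨Θ, hΘn, hΘd⟩ := Nat.chineseRemainder hnd θ ω
    have hmod : Θ % (n * d) ≡ Θ [MOD n * d] := Nat.mod_modEq Θ (n * d)
    refine ⟨Θ % (n * d), ?_, ?_⟩
    · rw [Finset.mem_filter, mem_rootsG]
      refine ⟨⟨Nat.mod_lt _ (Nat.mul_pos hn hd), ?_⟩, ?_⟩
      · -- root modulo `n` and modulo `d`, hence modulo `nd`
        have hΘroot : ((n * d : ℕ) : ℤ) ∣ quadVal a b c Θ := by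
          have h1 : (n : ℤ) ∣ quadVal a b c Θ :=
            dvd_quadVal_of_modEq (Int.natCast_modEq_iff.2 hΘn).symm hθ.2
          have h2 : (d : ℤ) ∣ quadVal a b c Θ :=
            dvd_quadVal_of_modEq (Int.natCast_modEq_iff.2 hΘd).symm hω
          push_cast
          exact (Nat.isCoprime_iff_coprime.2 hnd).mul_dvd h1 h2
        exact dvd_quadVal_of_modEq (Int.natCast_modEq_iff.2 hmod).symm hΘroot
      · exact (Nat.ModEq.of_mul_left n hmod).trans hΘd
    · have e : Θ % (n * d) ≡ θ [MOD n] := (Nat.ModEq.of_mul_right d hmod).trans hΘn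
      rw [Nat.ModEq] at e
      rw [e, Nat.mod_eq_of_lt hθ.1]

/-- The family as an iterated sum over `m` and then `Θ` (coprimality version). [folklore] -/
theorem card_lemma4FamilyG_eq_sum (q Q d μ ω A B : ℕ) :
    (lemma4FamilyG a b c q Q d μ ω A B).card =
      ∑ m ∈ (Finset.Ioc A B).filter (fun m => m.Coprime Q ∧ m ≡ μ [MOD d]),
        ((rootsG a b c (m * q)).filter (fun Θ => Θ ≡ ω [MOD d])).card := by
  classical
  set fam := lemma4FamilyG a b c q Q d μ ω A B with hfam
  set Mset := (Finset.Ioc A B).filter (fun m => m.Coprime Q ∧ m ≡ μ [MOD d]) with hMset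
  have hmaps : ∀ p ∈ fam, p.1 ∈ Mset := by
    intro p hp
    rw [hfam, mem_lemma4FamilyG] at hp
    rw [hMset, Finset.mem_filter, Finset.mem_Ioc]
    exact ⟨hp.1, hp.2.1, hp.2.2.1⟩
  rw [Finset.card_eq_sum_card_fiberwise hmaps]
  refine Finset.sum_congr rfl fun m hm => ?_
  rw [hMset, Finset.mem_filter, Finset.mem_Ioc] at hm
  refine Finset.card_bij (fun p _ => p.2) ?_ ?_ ?_
  · intro p hp
    rw [Finset.mem_filter, hfam, mem_lemma4FamilyG] at hp
    obtain ⟨⟨-, -, -, h4, h5⟩, rfl⟩ := hp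
    exact Finset.mem_filter.mpr ⟨h4, h5⟩
  · intro x hx y hy hxy
    rw [Finset.mem_filter] at hx hy
    exact Prod.ext (hx.2.trans hy.2.symm) hxy
  · intro Θ hΘ
    rw [Finset.mem_filter] at hΘ
    refine ⟨(m, Θ), ?_, rfl⟩
    rw [Finset.mem_filter, hfam, mem_lemma4FamilyG]
    exact ⟨⟨hm.1, hm.2.1, hm.2.2, hΘ.1, hΘ.2⟩, rfl⟩

/-- **The total count of the family**: for `Q` squarefree, `q ∣ Q`, `d ∣ q`, `ω` a root of `G`
mod `d` and `A ≤ B`:  `#lemma4FamilyG = ρ_G(q/d) (Σ₀(B; Q, d, μ) − Σ₀(A; Q, d, μ))`.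
[cite: IwaniecInventiones1978, Lemma 4] -/
theorem card_lemma4FamilyG_eq {q Q d μ ω A B : ℕ} (hQ : Squarefree Q) (hqQ : q ∣ Q) (hdq : d ∣ q)
    (hω : (d : ℤ) ∣ quadVal a b c ω) (hAB : A ≤ B) :
    ((lemma4FamilyG a b c q Q d μ ω A B).card : ℝ) =
      (rhoG a b c (q / d) : ℝ) * ((rhoSumAPG a b c B Q d μ : ℝ) - (rhoSumAPG a b c A Q d μ : ℝ)) := by
  classical
  have hQ0 : Q ≠ 0 := hQ.ne_zero
  have hq0 : 0 < q := Nat.pos_of_dvd_of_pos hqQ (Nat.pos_of_ne_zero hQ0)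
  have hd0 : 0 < d := Nat.pos_of_dvd_of_pos hdq hq0
  have hqsf : Squarefree q := hQ.squarefree_of_dvd hqQ
  set q' := q / d with hq'
  have hqeq : q' * d = q := Nat.div_mul_cancel hdq
  have hq'0 : 0 < q' := by
    rcases Nat.eq_zero_or_pos q' with h | h
    · rw [h, zero_mul] at hqeq; omega
    · exact h
  have hq'd : q'.Coprime d := by
    have := hqsf; rw [← hqeq, Nat.squarefree_mul_iff] at this; exact this.1
  set Mset := (Finset.Ioc A B).filter (fun m => m.Coprime Q ∧ m ≡ μ [MOD d]) with hMset
  have hm : ∀ m ∈ Mset, ((rootsG a b c (m * q)).filter (fun Θ => Θ ≡ ω [MOD d])).card =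
      rhoG a b c m * rhoG a b c q' := by
    intro m hm
    rw [hMset, Finset.mem_filter, Finset.mem_Ioc] at hm
    have hm0 : 0 < m := by omega
    have hmq : m.Coprime q := Nat.Coprime.coprime_dvd_right hqQ hm.2.1
    have hmq' : m.Coprime q' := Nat.Coprime.coprime_dvd_right (Dvd.intro d hqeq) hmq
    have hmd : m.Coprime d := Nat.Coprime.coprime_dvd_right hdq hmq
    have hnd : (m * q').Coprime d := Nat.Coprime.mul_left hmd hq'd
    rw [show m * q = (m * q') * d by rw [← hqeq]; ring,
      card_rootsG_filter_modEq (Nat.mul_pos hm0 hq'0) hd0 hnd hω, rhoG_mul_of_coprime hmq']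
  rw [card_lemma4FamilyG_eq_sum, Finset.sum_congr rfl hm, ← Finset.sum_mul, Nat.cast_mul,
    Nat.cast_sum, mul_comm]
  congr 1
  have hsplit : (Finset.Ioc 0 B).filter (fun m => m.Coprime Q ∧ m ≡ μ [MOD d]) =
      (Finset.Ioc 0 A).filter (fun m => m.Coprime Q ∧ m ≡ μ [MOD d]) ∪ Mset := by
    rw [hMset, ← Finset.filter_union, Finset.Ioc_union_Ioc_eq_Ioc (Nat.zero_le A) hAB]
  have hdisj : Disjoint ((Finset.Ioc 0 A).filter (fun m => m.Coprime Q ∧ m ≡ μ [MOD d])) Mset := by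
    rw [hMset]
    refine Finset.disjoint_filter_filter (Finset.disjoint_left.mpr fun x hx hx' => ?_)
    rw [Finset.mem_Ioc] at hx hx'
    omega
  rw [rhoSumAPG, rhoSumAPG, hsplit, Finset.sum_union hdisj]
  push_cast
  ring

end Literature.NumberTheory.Sieve.Iwaniec1978

end
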